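import Mathlib
import Literature.AlgebraicGeometry.Resolution.CobordantGame
import Summits.ResolutionOfSingularities.ResolutionOfSingularities.Theorems.WeightedInvariantLocalWeightedDropCharTwoDoublePointClassKeys
import Summits.ResolutionOfSingularities.ResolutionOfSingularities.Theorems.WeightedInvariantLocalWeightedDropMonicDoublePointDescends

/-!
# `WeightedInvariant.LocalWeightedDrop`, line `hasse-ridge-face-selection`: the registered stub S2iM `stub_charTwoInseparableReductionWon`
# CLOSED BY NAME from the lead's key `stub_monicDoublePointDescends`

Crux item stmt-ResolutionOfSingularities-8899 `LocalWeightedDrop` (route `ResolutionOfSingularities/WeightedInvariant`), skeleton v28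
(b8b73808bd522080).  [OURS · L1 W4.3, chain w43, stub worker 5 (seat res-D-pv-056); bookkeeping: the by-name corollary
`charTwoInseparableReduction_of_descends` (p496875) applied to the landed key.  The in-game class proof (stub worker 3's HW 2014 engine,
`…InsepStateLift` / `…InsepNewton*`) remains the calibration track (CHAIN D12).]
-/

set_option linter.dupNamespace false -- mandated namespace of this single-conjunct summit

namespace Summit.ResolutionOfSingularities.ResolutionOfSingularities.Theorems

open Literature.AlgebraicGeometry.Resolution

/-- S2iM — REDUCTION OF THE PURELY INSEPARABLE CHAR-2 DOUBLE POINTS `y² + A₀(x₁,x₂)` TO THE TERMINAL ONES (registered stub of skeleton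
v28, statement VERBATIM; «the kangaroo piece»): over an algebraically closed field of characteristic `2`, given the singular germs in `≤ 2`
variables and the terminal double points, every monic germ `y² + A₀` with `ord A₀ ≥ 3` is won.  Proof: the lead's key
`stub_monicDoublePointDescends` through `charTwoInseparableReduction_of_descends` (the terminal-case hypothesis is not used).  [OURS · L1 W4.3] -/
theorem stub_charTwoInseparableReductionWon : ∀ (k : Type) [Field k] [CharP k 2] [IsAlgClosed k],
      (∀ m : ℕ, m < 3 → ∀ g : MvPowerSeries (Fin m) k,
        CobordantGame.IsSingular k g → CobordantGame.Won k m g) →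
      (∀ (A₀ : MvPowerSeries (Fin 2) k), (2 : ℕ∞) < A₀.order →
        ((∃ (r s : ℕ) (U : MvPowerSeries (Fin 2) k), MvPowerSeries.constantCoeff U ≠ 0 ∧ ¬ (2 ∣ r ∧ 2 ∣ s) ∧
            A₀ = MvPowerSeries.X (0 : Fin 2) ^ r * MvPowerSeries.X (1 : Fin 2) ^ s * U) ∨
          (∃ (i : Fin 2) (m : ℕ) (g : MvPowerSeries (Fin 2) k), 0 < m ∧ g.order = 1 ∧
            A₀ = MvPowerSeries.X i ^ (2 * m) * g)) →
        CobordantGame.Won k 3 (MvPowerSeries.X (Fin.last 2) ^ 2 +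
          MvPowerSeries.rename (Fin.succAboveEmb (Fin.last 2)) A₀)) →
      ∀ (A₀ : MvPowerSeries (Fin 2) k), (2 : ℕ∞) < A₀.order →
        CobordantGame.Won k 3 (MvPowerSeries.X (Fin.last 2) ^ 2 +
          MvPowerSeries.rename (Fin.succAboveEmb (Fin.last 2)) A₀) :=
  charTwoInseparableReduction_of_descends stub_monicDoublePointDescends

end Summit.ResolutionOfSingularities.ResolutionOfSingularities.Theorems
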